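import Summits.AtomisticToContinuum.HydrodynamicLimit.Theses.TwoClocks
import Literature.MathematicalPhysics.KineticTheory.HardSphereEulerLLN

/-!
# Sketch — first lemmas of the crux-idea card `tagged-frozen-net-clock`
# for `TwoClocks.TransferEntropyClock` (stmt-AtomisticToContinuum-16625), ideator 2, round 1

Statements (and two easy proofs). Nothing here is asserted about the filed crux beyond the
kernel-checked composition `transferEntropyClock_of_taggedNetClock`.

* §1 `taggedNet_gronwall` — the variable-rate ("tagged-net") discrete Grönwall lemma the frozen-net
  clock runs on: interval `k` of length `Δ k` is run at its OWN rate `r k = 1/β_k + 1/γ`; the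
  amplification is `exp (Σ r k Δ k)`, a Riemann sum of `∫ ds/β(s)` with free tags (PROVED).
* §2 `uscEnv`, `tagged_rate_sums_bounded` — tags chosen at near-maximisers of the tilt threshold in
  each mesh cell keep the rate sums bounded along meshes `→ 0` as soon as the reciprocal of the
  upper-semicontinuous envelope of the threshold is integrable (statement; monotone convergence).
* §3 the two POINTWISE `∀β` local nodes the clock consumes with NO family typing:
  `KineticWindowLDBoundedAllBeta` (byte-identical with R1 =
  `QuenchedCellClock.KineticWindowLDUniformBounded` of `Cruxes/ClampedEntropyClock/Lines/IdeatorTwoSketch_restated.lean`)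
  and `LocalClampedTransferWindowLDAllBeta` (= `QuenchedCellClock.LocalClampedTransferWindowLDUniform`
  with `∃ β₀ ∀ |β| ≤ β₀` replaced by `∀ β`: the clamped rows are pathwise bounded, so every tilt is finite).
* §4 `TaggedNetClock` (the line's heart + landed glue, as ONE implication) and the composition
  `transferEntropyClock_of_taggedNetClock : TaggedNetClock → KineticWindowLDBoundedAllBeta →
  LocalClampedTransferWindowLDAllBeta → TransferEntropyClock` (PROVED, pure logic: the crux's own
  window-LD antecedents `KineticWindowLDUniform`, `ClampedTransferWindowLD` are superseded by the two
  pointwise nodes; `TransferActivityTails`, `EnergyCurrentTails`, `DiluteSelfConsistency` are consumed).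
-/

noncomputable section

namespace Summit.AtomisticToContinuum.HydrodynamicLimit.Cruxes.TransferEntropyClock.IdeatorTwoSketch

open MeasureTheory Set Filter Topology InformationTheory
open scoped ENNReal Classical BigOperators
open Literature.MathematicalPhysics.KineticTheory Literature.Analysis.FluidPDE Literature.Analysis.FunctionSpaces
open Summit.AtomisticToContinuum.HydrodynamicLimit.Theses.TwoClocks

/-! ## §1 The variable-rate (tagged-net) discrete Grönwall lemma -/

/-- **Tagged-net Grönwall.** If `h (k+1) ≤ (1 + r k * Δ k) * h k + Δ k * e k` with nonnegative
rates, lengths and errors, then `h n ≤ exp (Σ_{k<n} r k Δ k) · (h 0 + Σ_{k<n} Δ k e k)`.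
In the frozen-net clock `h k = H_N(s_k)/(N+1)`, `Δ k = s_{k+1} - s_k`, `r k = 1/β_k + 1/γ` with
`β_k` the dynamical tilt admissible at the TAG `s_k` and `γ` the fixed static tilt, and
`e k = ε/β_k + C Δ k + tails`: the amplification `exp (Σ Δ k/β_k)` is a tagged Riemann sum of
`∫ ds/β(s)` — the only place the tilt thresholds enter. [folklore] -/
theorem taggedNet_gronwall (h Δ r e : ℕ → ℝ)
    (hΔ : ∀ k, 0 ≤ Δ k) (hr : ∀ k, 0 ≤ r k) (he : ∀ k, 0 ≤ e k) (h0 : 0 ≤ h 0)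
    (hstep : ∀ k, h (k + 1) ≤ (1 + r k * Δ k) * h k + Δ k * e k) (n : ℕ) :
    h n ≤ Real.exp (∑ k ∈ Finset.range n, r k * Δ k) *
      (h 0 + ∑ k ∈ Finset.range n, Δ k * e k) := by
  induction n with
  | zero => simp
  | succ n ih =>
    set S : ℝ := ∑ k ∈ Finset.range n, r k * Δ k with hSdef
    set E : ℝ := ∑ k ∈ Finset.range n, Δ k * e k with hEdef
    have hSnn : 0 ≤ S := Finset.sum_nonneg fun k _ => mul_nonneg (hr k) (hΔ k)
    have hEnn : 0 ≤ E := Finset.sum_nonneg fun k _ => mul_nonneg (hΔ k) (he k)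
    have hx : 0 ≤ r n * Δ n := mul_nonneg (hr n) (hΔ n)
    have h1 : 1 + r n * Δ n ≤ Real.exp (r n * Δ n) := by
      linarith [Real.add_one_le_exp (r n * Δ n)]
    have h1' : 0 ≤ 1 + r n * Δ n := by linarith
    have hexpS : 0 ≤ Real.exp S := (Real.exp_pos _).le
    have hlast : 0 ≤ Δ n * e n := mul_nonneg (hΔ n) (he n)
    have hbase : 0 ≤ Real.exp S * (h 0 + E) := mul_nonneg hexpS (add_nonneg h0 hEnn)
    have hge1 : 1 ≤ Real.exp S * Real.exp (r n * Δ n) := by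
      rw [← Real.exp_add]
      exact Real.one_le_exp (add_nonneg hSnn hx)
    rw [Finset.sum_range_succ, Finset.sum_range_succ, Real.exp_add]
    calc h (n + 1) ≤ (1 + r n * Δ n) * h n + Δ n * e n := hstep n
      _ ≤ (1 + r n * Δ n) * (Real.exp S * (h 0 + E)) + Δ n * e n := by
          have := mul_le_mul_of_nonneg_left ih h1'
          linarith
      _ ≤ Real.exp (r n * Δ n) * (Real.exp S * (h 0 + E)) + Δ n * e n := by
          have := mul_le_mul_of_nonneg_right h1 hbase
          linarith
      _ ≤ Real.exp (r n * Δ n) * (Real.exp S * (h 0 + E)) +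
            Real.exp S * Real.exp (r n * Δ n) * (Δ n * e n) := by
          nlinarith [hge1, hlast]
      _ = Real.exp S * Real.exp (r n * Δ n) * (h 0 + (E + Δ n * e n)) := by ring

/-! ## §2 Tags at near-maximisers of the tilt threshold: the residual `∫ ds/β^*(s) < ∞` -/

/-- The upper-semicontinuous envelope of a positive threshold function, capped at `1`
(`β^*(s) = inf_δ sup_{|s'-s|<δ} min(β s', 1)`). [folklore] -/
def uscEnv (β : ℝ → ℝ) (s : ℝ) : ℝ :=
  ⨅ δ : {δ : ℝ // 0 < δ}, sSup ((fun s' => min (β s') 1) '' Metric.ball s (δ : ℝ))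

/-- **Tag selection.** If `1/β^*` is integrable on `[0,t]` then along the uniform meshes `t/n` one can
choose tags `s_k` in the cells with `Σ_k (t/n)/min(β(s_k),1)` bounded independently of `n`
(choose `s_k` with `min(β(s_k),1) ≥ ½ sup_cell`, then `Σ (t/n)/sup_cell ≤ ∫ ds/β^*` by monotone
convergence of the cellwise suprema to the envelope). Conversely (not typed) the tagged sums are
bounded along some meshes `→ 0` only if `∫ ds/β^* < ∞`: this is the EXACT tilt residual of every
frozen-reference entropy clock. Statement only. [folklore] -/
theorem tagged_rate_sums_bounded (β : ℝ → ℝ) (hβ : ∀ s, 0 < β s) {t : ℝ} (ht : 0 < t)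
    (hint : IntegrableOn (fun s => (uscEnv β s)⁻¹) (Set.Icc 0 t)) :
    ∃ B : ℝ, ∀ n : ℕ, 0 < n → ∃ tag : ℕ → ℝ,
      (∀ k < n, tag k ∈ Set.Icc ((k : ℝ) * (t / n)) (((k : ℝ) + 1) * (t / n))) ∧
      ∑ k ∈ Finset.range n, (t / n) / min (β (tag k)) 1 ≤ B := by
  sorry

/-! ## §3 The two POINTWISE `∀β` local nodes -/

/-- **Kinetic node: bounded fast functionals, every tilt, thresholds pointwise in the reference**
(byte-identical with R1 = `QuenchedCellClock.KineticWindowLDUniformBounded`). Frame of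
`KineticWindowLDUniform` (local Gibbs data, `η₀`-uniform packing guard, `F` continuous, BOUNDED,
orthogonal at every `x` under `M_(1,u₀(x),θ₀(x))` to `1, v_j, |v|²`); conclusion `∀ β ∀ ε ∃ τ ∃ N₀`.
Consumed by the truncated stress AND the truncated heat flux (quadratic stress tails are priced by
the static Gaussian entropy inequality at a fixed static tilt, cubic tails by `EnergyCurrentTails`).
[folklore] -/
def KineticWindowLDBoundedAllBeta : Prop :=
  ∃ η₀ : ℝ, 0 < η₀ ∧ ∀ (a θ₀ : T3 → ℝ) (u₀ : T3 → V3), Continuous a → Continuous θ₀ → Continuous u₀ → (∀ x, 0 < a x) →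
    (∀ x, 0 < θ₀ x) → ∀ σ : ℝ, 0 < σ → σ ^ 3 * (⨆ x, a x) ≤ η₀ * ∫ x, a x →
    ∀ Φ : (N : ℕ) → HardSphereFlow (Torus.geometry (Fin 3)) (hsDiameter σ N) (N + 1),
    ∀ F : T3 × V3 → ℝ, Continuous F → (∃ C : ℝ, ∀ y, |F y| ≤ C) →
    (∀ x, ∫ v, F (x, v) * localMaxwellian 1 (θ₀ x) (u₀ x) v = 0) →
    (∀ x (j : Fin 3), ∫ v, F (x, v) * v j * localMaxwellian 1 (θ₀ x) (u₀ x) v = 0) →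
    (∀ x, ∫ v, F (x, v) * ‖v‖ ^ 2 * localMaxwellian 1 (θ₀ x) (u₀ x) v = 0) →
    ∀ β : ℝ, ∀ ε : ℝ, 0 < ε → ∃ τ : ℝ, 0 < τ ∧ ∃ N₀ : ℕ, ∀ N : ℕ, N₀ ≤ N →
      ∫⁻ z, ENNReal.ofReal (Real.exp (β * ∑ i : Fin (N + 1), (τ * ((N : ℝ) + 1) ^ (-(1 / 3 : ℝ)))⁻¹ *
          ∫ r in (0 : ℝ)..(τ * ((N : ℝ) + 1) ^ (-(1 / 3 : ℝ))), F (((Φ N).flow r z) i)))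
        ∂(localGibbsLaw σ a u₀ θ₀ N (Φ N)) ≤ ENNReal.ofReal (Real.exp (ε * ((N : ℝ) + 1)))

/-- **Collisional node: the LOCAL clamped collisional-transfer window LD, every tilt, thresholds
pointwise in the reference** (= `QuenchedCellClock.LocalClampedTransferWindowLDUniform` with
`∃ β₀ ∀ |β| ≤ β₀` replaced by `∀ β`; transfer-activity clamp C′, x-frozen EOS coefficients through
`ρ₀ = rhoLim (profileOf a) σ`, deterministic centring; quantifiers
`∃η₀ ∀data ∀Φ ∀φ ∃V₀ ∀V ∀β ∀ε ∃τ₀ ∀τ≥τ₀ ∃N₀ ∀N`). All four rows are pathwise bounded by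
`½‖∇φ‖V(N+1)` after `w⁻¹`, so every tilt is finite at every `N`. [folklore] -/
def LocalClampedTransferWindowLDAllBeta : Prop :=
  ∃ η₀ : ℝ, 0 < η₀ ∧ ∀ (a θ₀ : T3 → ℝ) (u₀ : T3 → V3) (ha : Continuous a), Continuous θ₀ → Continuous u₀ →
    ∀ (ha0 : ∀ x, 0 < a x), (∀ x, 0 < θ₀ x) → ∀ σ : ℝ, 0 < σ → σ < 1 / 2 → σ ^ 3 * (⨆ x, a x) ≤ η₀ * ∫ x, a x →
    ∀ Φ : (N : ℕ) → HardSphereFlow (Torus.geometry (Fin 3)) (hsDiameter σ N) (N + 1),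
    ∀ φ : T3 → ℝ, Torus.IsSmooth φ →
    ∃ V₀ : ℝ, 0 < V₀ ∧ ∀ V : ℝ, V₀ ≤ V → ∀ β : ℝ, ∀ ε : ℝ, 0 < ε →
    ∃ τ₀ : ℝ, 0 < τ₀ ∧ ∀ τ : ℝ, τ₀ ≤ τ → ∃ N₀ : ℕ, ∀ N : ℕ, N₀ ≤ N →
      (let ρ₀ : T3 → ℝ := rhoLim (profileOf a ha ha0) σ
       let w : ℝ := τ * ((N : ℝ) + 1) ^ (-(1 / 3 : ℝ))
       let P := localGibbsLaw σ a u₀ θ₀ N (Φ N)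
       let Z : T3 → ℝ := fun x => hsCompressibility (ρ₀ x * σ ^ 3)
       let Z' : T3 → ℝ := fun x => deriv hsCompressibility (ρ₀ x * σ ^ 3)
       let act := fun (i : Fin (N + 1)) (z : Config (N + 1) (Fin 3) T3) =>
         σ / τ * (Φ N).collisionSum (Set.Ioc 0 w) (fun c => if c.fst = i then
           ‖c.postVel.1 - c.preVel.1‖ + |‖c.postVel.1‖ ^ 2 - ‖c.preVel.1‖ ^ 2| / 2 else 0) z
       let ω := fun (i : Fin (N + 1)) (z : Config (N + 1) (Fin 3) T3) => if act i z ≤ V then (1 : ℝ) else 0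
       let Xm := fun (k : Fin 3) (z : Config (N + 1) (Fin 3) T3) =>
         (Φ N).collisionSum (Set.Ioc 0 w)
           (fun c => ω c.fst z * ω c.snd z * ((φ c.fstPos - φ c.sndPos) * (c.postVel.1 k - c.preVel.1 k)) / 2) z
       let Am := fun (k : Fin 3) (z : Config (N + 1) (Fin 3) T3) =>
         (∫ r in (0 : ℝ)..w, ∑ i : Fin (N + 1), Torus.partialDeriv k φ ((Φ N).flow r z i).1 *
           (θ₀ ((Φ N).flow r z i).1 * (ρ₀ ((Φ N).flow r z i).1 * σ ^ 3) * Z' ((Φ N).flow r z i).1 +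
             (1 / 3) * (Z ((Φ N).flow r z i).1 - 1) * ‖((Φ N).flow r z i).2 - u₀ ((Φ N).flow r z i).1‖ ^ 2)) -
         w * ((N : ℝ) + 1) * ∫ x, ρ₀ x * Torus.partialDeriv k φ x * (θ₀ x * (ρ₀ x * σ ^ 3) * Z' x)
       let Xe := fun (z : Config (N + 1) (Fin 3) T3) =>
         (Φ N).collisionSum (Set.Ioc 0 w)
           (fun c => ω c.fst z * ω c.snd z *
             ((φ c.fstPos - φ c.sndPos) * ((‖c.postVel.1‖ ^ 2 - ‖c.preVel.1‖ ^ 2) / 2)) / 2) z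
       let Ae := fun (z : Config (N + 1) (Fin 3) T3) =>
         (∫ r in (0 : ℝ)..w, ∑ i : Fin (N + 1),
           ((∑ l : Fin 3, u₀ ((Φ N).flow r z i).1 l * Torus.partialDeriv l φ ((Φ N).flow r z i).1) *
               (θ₀ ((Φ N).flow r z i).1 * (ρ₀ ((Φ N).flow r z i).1 * σ ^ 3) * Z' ((Φ N).flow r z i).1 +
                 (1 / 3) * (Z ((Φ N).flow r z i).1 - 1) * ‖((Φ N).flow r z i).2 - u₀ ((Φ N).flow r z i).1‖ ^ 2) +
             θ₀ ((Φ N).flow r z i).1 * (Z ((Φ N).flow r z i).1 - 1) *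
               (∑ l : Fin 3, Torus.partialDeriv l φ ((Φ N).flow r z i).1 *
                 (((Φ N).flow r z i).2 - u₀ ((Φ N).flow r z i).1) l))) -
         w * ((N : ℝ) + 1) *
           ∫ x, ρ₀ x * (∑ l : Fin 3, u₀ x l * Torus.partialDeriv l φ x) * (θ₀ x * (ρ₀ x * σ ^ 3) * Z' x)
       (∀ k : Fin 3, ∫⁻ z, ENNReal.ofReal (Real.exp (β * (w⁻¹ * Xm k z - w⁻¹ * Am k z))) ∂P ≤
           ENNReal.ofReal (Real.exp (ε * ((N : ℝ) + 1)))) ∧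
         ∫⁻ z, ENNReal.ofReal (Real.exp (β * (w⁻¹ * Xe z - w⁻¹ * Ae z))) ∂P ≤
           ENNReal.ofReal (Real.exp (ε * ((N : ℝ) + 1))))

/-! ## §4 The clock as ONE implication, and the composition that concludes the crux by name -/

/-- **The tagged frozen-net clock** (the line's heart + landed glue): Yau's relative entropy along
references FROZEN on a finite time net, switched at the net points (exact telescoping of the
one-body tilt functional; `H(f‖G)` conserved), each interval run at its own tilt, fed by the two
POINTWISE `∀β` local nodes (so the residual `∫ ds/β^* < ∞` of §2 is vacuous and only finitely many
reference instances are ever invoked: `τ, N₀` by `max` over the net), the clamp priced by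
`TransferActivityTails`, the cubic heat-flux tail by `EnergyCurrentTails`, the guard by
`DiluteSelfConsistency`; the statics `UniformLocalGibbsConcentration`, `HsEosLowDensity` and the
entropy inequality `EntropyToHydro` (all PROVED) are lemmas inside. [cite: Yau1991, §2]
[cite: OllaVaradhanYau1993, §3] [cite: KipnisLandim1999, Ch. 6 §1] -/
def TaggedNetClock : Prop :=
  KineticWindowLDBoundedAllBeta → LocalClampedTransferWindowLDAllBeta → TransferActivityTails →
    EnergyCurrentTails → DiluteSelfConsistency → _root_.HydrodynamicLimit

/-- **Composition: the clock and the two pointwise nodes conclude the crux BY NAME.** The crux's own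
window-LD antecedents `KineticWindowLDUniform` (∃β₀ per instance, quadratic growth) and
`ClampedTransferWindowLD` (global equilibrium) are superseded (idle binders): by the UNIFORMITY /
EnergyRowShapes / LocalityRowShapes findings no entropy clock consumes them as typed, and the card's
§Lever shows the exact residual they would have to satisfy. [folklore] -/
theorem transferEntropyClock_of_taggedNetClock (hC : TaggedNetClock) (hK : KineticWindowLDBoundedAllBeta)
    (hL : LocalClampedTransferWindowLDAllBeta) : TransferEntropyClock :=
  fun _ _ hT hE hD => hC hK hL hT hE hD

/-- Sanity: the clock is weaker than the Statement (irrefutable short of `¬ HydrodynamicLimit`, like the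
crux itself). [folklore] -/
theorem taggedNetClock_of_hydrodynamicLimit (h : _root_.HydrodynamicLimit) : TaggedNetClock :=
  fun _ _ _ _ _ => h

end Summit.AtomisticToContinuum.HydrodynamicLimit.Cruxes.TransferEntropyClock.IdeatorTwoSketch
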